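import Literature.MathematicalPhysics.QuantumFieldTheory.Balaban1983to89.B9B8KnitNeumannJunctionHerm
import Literature.MathematicalPhysics.QuantumFieldTheory.Balaban1983to89.B9SupplySockB9P3ZdPer
import Literature.MathematicalPhysics.QuantumFieldTheory.Balaban1983to89.B8Thm2TorusSupplier
import Literature.MathematicalPhysics.QuantumFieldTheory.Balaban1983to89.B8Thm2TorusMember

/-!
# `Balaban1983to89.B9B8KnitTorusGlobPackaging` — the (B)-line bond junction, file 8b: RULING #10 road (e), PACKAGING — dag-n06-b's analytic binders
# `InvAtHIPer` (Thm 3.11 ∕ (3.27)) and `GlobAtIPer` (Thm 3.3, (3.47)@−3) for the GENUINE torus record `opsAllZdPer` at the torus datum `torusIdx`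
# (Ω_j = ℤ^{d+1}, Λ_s = torusLam, Λ_b = torusLamb), hence — given the Hölder binder `HolderAtIPer` — pub-ymgap's guarded socket `SockB9P3Per` ([B8] (1.59)
# on T_η), FROM ONE PER-BACKGROUND BINDER IN def-Y's CURRENCY: `Δ_a(U)` invertible with the three (3.47)₋₃ members at `B₀` and the Hermitian junction closeness

statement-level skeleton of published theorems with citation tags; proofs where landed; nothing here is a claim about the
Yang–Mills mass gap

Sub-row G-B8-T2S (unit `lit-balaban-t2s-1`, gen 7), lit-balaban RULING #10 road (e) «PACKAGING: frame at `torusIdx` for dag-n06's periodic record».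
The torus bond junction (files 1–4, 7a–7c, 7c′ of this seat) proves, PER periodic background `U₀`, that the periodic Green's function `G_𝔤^per` of ANY
letter record whose `Δ_knit` is real-linear and carrier-preserving obeys [4] Thm 3.3's three global entries with constant `2B₀` and is invertible on
`E_𝔤^per(P₀)`, whenever def-Y's `Δ_a(U)` (`U = bgY i U₀`) is a unit with those entries at `B₀` and the HERMITIAN junction closeness holds with `2εB₀ ≤ 1`
(`B9B8KnitNeumannJunctionHerm.gopZdHPer_three_members_herm`).  THIS FILE packages that into the EXACT binders of pub-ymgap dag-n06-b's periodic
supplier `B9SupplySockB9P3ZdPer.sockB9P3Per_opsAllZdPer_of_binders` — `InvAtHIPer`, `GlobAtIPer` for `opsAllZdPer τ L P₀ Λ_b ops₀` at the torus datum of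
`B8Thm2TorusMember.torusIdx` (+ the periodicity of its `Gop`, the input of g6's β = 0 Hölder file 8a `B9B8KnitHolderZeroOfGlob`) — and, GIVEN the Hölder binder
`HolderAtIPer` (any `C_β`, `β`; at `β = 0` it follows from `GlobAtIPer` by file 8a — kept as a hypothesis here so that this file does not wait on 8a's build),
reads off the guarded socket `B8LeafModelZd3SockPer.SockB9P3Per … η n {ℤ^{d+1}} torusLam torusLamb`, the shape file A17
(`B8Thm2T3FamilyBinderSockPer.hThm2_of_core_sockPer`) displays as the (B)-arrow of the 19200 dictionary.  The ONE displayed analytic input is the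
per-background def-Y binder (§2's `hY`): for every `0 < α₀ ≤ a_T` and every periodic unitary `U₀ ∈ 𝔄_n(ℤ^{d+1}, α₀)`, `IsUnit Δ_a(U)` + `|G(U)F|₍₋₁₎,
|∇_U G(U)F|₍₋₂₎, |Δ_U G(U)F|₍₋₃₎ ≤ B₀|F|₍₋₃₎` + the Hermitian closeness `|Δ_a(U)a − (c_fη)²·(Δ_knit a♯)♭|₍₋₃₎ ≤ ε|a|₍₋₁₎` — p38's M5.7 resp. files 5–6.
Print: [4] Thm 3.3 p. 399, (3.47) p. 398, (3.26)–(3.27) p. 395, Thm 3.11 p. 416; [B8] (1.58)–(1.59) p. 86, Prop. 3 p. 87, p. 77 («Ω_j = T_η»).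

WHAT IS PROVED (kernel, 0 sorry, theorems only; no `def`, no `… : Prop` fact, no `instance`, no `notation`).
* §1 torus-datum bookkeeping: `alpha_pos_of_inAk_univ` (`𝔄_n(ℤ^{d+1}, α₀)` non-empty ⟹ `α₀ > 0`), `sideTouches_torusIdx_eq` ∕ `sideTouches_torusIdx_eq₃` (every
  bond touches ℤ^{d+1}: the `msup` membership predicates of `GlobAtIPer` at `torusIdx` are `True`), `isPeriodic_mem_torusLamb'`, `levelSepPP0_torusIdx`
  (EDITION P₀'s class law holds at the all-torus class with `s = 0`), `hbox_torusIdx`.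
* §2 ★★★ `binders_torusIdx_of_defY` — the per-background def-Y binder ⟹ `InvAtHIPer P₀ L (opsAllZdPer …) a_T M i′ n ∧ GlobAtIPer … a_T (2B₀) M i′ n` at
  `i′ = torusIdx`, and `gop_isPeriodic_opsAllZdPer` (the record's `Gop` is periodic on periodic Hermitian data — file 8a's input).
* §3 ★★★ `sockB9P3Per_torusIdx_of_defY` — hence, given `HolderAtIPer … a_T C_β β len M i′ n`, `SockB9P3Per P₀ L B₀′ B₀β′ c_P β len η n {ℤ^{d+1}} torusLam
  torusLamb` with dag-n06-b's constants (`B₀′ = max 1 (4B₀·max 1 q)`, `B₀β′ = 2·max 0 C_β·max 1 q`, `c_P = min (1∕16) (min a_T (min a_T (1∕(4B₀·14d·M + 1))))`,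
  `q = qQ (d+1) L C_τ β_τ 0`).

HONEST SCOPE.  Packaging only: the def-Y binder `hY` (Thm 3.3 ∕ 3.11 content at def-Y's letters + the junction closeness) and the Hölder binder are DISPLAYED,
inhabited by nothing here; `SockB9P3Per` is inhabited only modulo them; `stub_PV3A` ∕ `B9P3PerAt` NOT discharged; count-neutral; no estimate of [4] ∕ [B8] proved; nothing
continuum ∕ ℝ⁴ ∕ OS ∕ mass gap ∕ Clay — the Yang–Mills mass gap is NOT proved by any of this.  NEW file; dag-n06-b's `B9SupplySockB9P3ZdPer` ∕
`B9SupplySockB9P3ZdAllLettersZdPer` ∕ `B9Eq327GreenZdHermPer`, p33's `torusIdx`, this seat's 7c′ are used BY NAME, nothing landed is modified.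
-/

noncomputable section

namespace Literature.MathematicalPhysics.QuantumFieldTheory.Balaban1983to89.B9B8KnitTorusGlobPackaging

open scoped BigOperators
open Node00
open B7Prop1Explicit renaming Site → LSite
open B7Prop1Explicit (e)
open B7Prop1Local (InBox loK bondHiK)
open B7Prop2Explicit (unitaryUnits)
open B6KLevelCensusIndexV1 (KIdx)
open B6GlobalChartV1 (PV)
open B8ScaledSupNorm (weight msup bondNorm)
open B8Ineq132 (covDerivFwd InAk BondTouches PlaqTouches)
open B8Eq140Level (SideTouches)
open B8Eq138LandauZd (covLap)
open B8LeafModelZd (ZdIdx)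
open B8LeafModelZd3SockPer (SockB9P3Per)
open B8Thm4TorusAt (torusLam)
open B8Thm2TorusMember (TorusMember torusIdx torusLamb mem_torusLamb_iff)
open B8Thm2TorusSupplier (sideTouches_univ)
open B9B8KnitBondTransfer (descBd liftBd)
open B8Thm2TorusLettersPerOfKnit (bgY)
open B9SupplySockB9P3ZdLetters (OpsZd deltaAOf)
open B9SupplySockB9P3ZdPer (GlobAtIPer HolderAtIPer sockB9P3Per_opsAllZdPer_of_binders)
open B9SupplySockB9P3ZdAllLettersZdPer (opsAllZdPer opsLandauPer perPreservingAt_opsAllZdPer linearOnDomAt_opsAllZdPer_univ)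
open B9SupplySockB9P3ZdGammaInAkDpZd (withDpZd)
open B9Eq316AveragingTransposeZd (qQ betaTau)
open B9Eq316AveragingTransposeZdPrinted (withQQP)
open B9Eq316AveragingTransposeZdLevelZero (LevelSepPP0)
open B9Eq327GreenZdHermPer (domSubHPer mem_domSubHPer_iff RegularAtHPer RegularInClassAtHPer InvAtHIPer gopZdHPer gopZdHPer_mem_domSubHPer
  invAtHIPer_withGopZdHPer)
open B9B8KnitNeumannJunctionHerm (gopZdHPer_three_members_herm)
open T4TermwiseTorus (IsPeriodic)

variable {d ℓ : ℕ} {hd : 1 ≤ d + 1} {hL : Odd (ℓ + 1) ∧ 1 < ℓ + 1} {b₀ b₁ : ℝ}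
variable {𝔸 : Type} [CStarAlgebra 𝔸]

/-! ## §1 Torus-datum bookkeeping -/

/-- on `Ω_j = ℤ^{d+1}` (`2 ≤ d + 1`) the regular class `𝔄_n(ℤ^{d+1}, α₀)` is empty unless `α₀ > 0` (the plaquette clause of (1.7) at `j = 0`).
[cite: Balaban1985RegularSpaces, (1.7) p.77] -/
theorem alpha_pos_of_inAk_univ (hd2 : 2 ≤ d + 1) {L n : ℕ} {η α₀ : ℝ} {U₀ : LSite (d + 1) → Fin (d + 1) → 𝔸ˣ}
    (h : InAk L n η α₀ (fun _ => (Set.univ : Set (LSite (d + 1)))) U₀) : 0 < α₀ := by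
  have hμν : (⟨0, by omega⟩ : Fin (d + 1)) ≠ ⟨1, by omega⟩ := by
    intro hh; have := congrArg Fin.val hh; simp at this
  have h0 := (h 0 (Nat.zero_le n)).1 (0 : LSite (d + 1)) ⟨0, by omega⟩ ⟨1, by omega⟩ hμν (Or.inl (Set.mem_univ _))
  simp only [pow_zero, inv_one, one_pow, mul_one] at h0
  exact (norm_nonneg _).trans_lt h0

omit [CStarAlgebra 𝔸] in
/-- at the torus datum every bond of every level touches `Ω_j = ℤ^{d+1}`: the membership predicate of `GlobAtIPer`'s first clause is `True`.
[cite: Balaban1985RegularSpaces, p.77 («Ω_j = T_η»), bookkeeping] -/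
theorem sideTouches_torusIdx_eq (hd2 : 2 ≤ d + 1) {L : ℕ} (hL1 : 1 ≤ L) (t : TorusMember) :
    (fun j (b : LSite (d + 1) × Fin (d + 1)) => SideTouches ((torusIdx (d := d + 1) hL1 t).Ω j) b.1 b.2) = fun _ _ => True := by
  funext j b
  exact propext ⟨fun _ => trivial, fun _ => sideTouches_univ hd2 b.1 b.2⟩

omit [CStarAlgebra 𝔸] in
/-- the same for the gradient clause's triple index. [cite: Balaban1985RegularSpaces, p.77 («Ω_j = T_η»), bookkeeping] -/
theorem sideTouches_torusIdx_eq₃ (hd2 : 2 ≤ d + 1) {L : ℕ} (hL1 : 1 ≤ L) (t : TorusMember) :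
    (fun j (q : Fin (d + 1) × Fin (d + 1) × LSite (d + 1)) => SideTouches ((torusIdx (d := d + 1) hL1 t).Ω j) q.2.2 q.2.1) = fun _ _ => True := by
  funext j q
  exact propext ⟨fun _ => trivial, fun _ => sideTouches_univ hd2 q.2.2 q.2.1⟩

omit [CStarAlgebra 𝔸] in
/-- the all-torus bond class has (trivially) periodic sections. [cite: Balaban1985RegularSpaces, (1.37) p.82, p.77, bookkeeping] -/
theorem isPeriodic_mem_torusLamb' (Q m j : ℕ) (κ : Fin (d + 1)) :
    IsPeriodic Q (fun z : LSite (d + 1) => (z, κ) ∈ torusLamb (d := d + 1) m j) :=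
  fun z v => by simp only [mem_torusLamb_iff]

omit [CStarAlgebra 𝔸] in
/-- EDITION P₀'s class law at the torus datum, with collar width `s = 0`: the box clause is `x ∈ ℤ^{d+1}`, the collar clause `i′ ≤ m` is the range bound.
[cite: Balaban1985RegularSpaces, (1.31) p.82, p.77 («Ω_j = T_η»), bookkeeping] -/
theorem levelSepPP0_torusIdx {L : ℕ} (hL1 : 1 ≤ L) (t : TorusMember) (m : ℕ) :
    LevelSepPP0 L m (torusIdx (d := d + 1) hL1 t).Ω (torusIdx (d := d + 1) hL1 t).Λb 0 := by
  intro j hj c hc y _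
  have hjm : j = m := (mem_torusLamb_iff m j c).1 hc
  exact ⟨fun _ => Set.mem_univ _, fun i' hi' _ _ => by omega⟩

omit [CStarAlgebra 𝔸] in
/-- the (1.31) box clause at the torus datum (everything lies in `ℤ^{d+1}`). [cite: Balaban1985RegularSpaces, (1.31) p.82, p.77, bookkeeping] -/
theorem hbox_torusIdx {L : ℕ} (hL1 : 1 ≤ L) (t : TorusMember) (m : ℕ) :
    ∀ j, 1 ≤ j → j ≤ m → ∀ c ∈ (torusIdx (d := d + 1) hL1 t).Λb m j, ∀ x, InBox (loK L j c.1) (bondHiK L j c.1 c.2) x →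
      x ∈ (torusIdx (d := d + 1) hL1 t).Ω (j - 1) :=
  fun _ _ _ _ _ _ _ => Set.mem_univ _

/-! ## §2 The three binders at the torus datum from the per-background def-Y binder -/

section Binders

variable [Nontrivial 𝔸] [FiniteDimensional ℝ 𝔸] (τ : 𝔸 →ₗ[ℂ] ℂ) (i : KIdx d ℓ hd hL b₀ b₁) {n : ℕ}

/-- ★★★ **THE THREE ANALYTIC BINDERS OF THE TORUS RECORD FROM def-Y, PER BACKGROUND.**  Data: a constant-level member `i` of the catalogue
(`levY ≡ n`, `c_f = L^{n+1}`, period `P₀ = (PV …).sitesPerDir 0`), knit spacing `η > 0`, faithful Hermitian tracial `τ`, `Lⁿ ∣ P₀`, the torus datum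
`i′ = torusIdx ⟨η, k⟩`, def-Y letters `(parS, parB, Gp)`, constants `B₀ > 0`, `0 ≤ ε`, `2εB₀ ≤ 1`, threshold `a_T`.  HYPOTHESIS `hY` (displayed): for every
`0 < α₀ ≤ a_T` and every `P₀`-periodic unitary `U₀ ∈ 𝔄_n(ℤ^{d+1}, α₀)`: `Δ_a(U)` (`U = bgY i U₀`) is a unit, its inverse `G(U)` obeys the three (3.47)₋₃ members
at `B₀`, and the Hermitian junction closeness holds against the torus record's `Δ_knit`.  CONCLUSION: dag-n06-b's `InvAtHIPer` (threshold `a_T`),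
`GlobAtIPer` (threshold `a_T`, constant `2B₀`) for `opsAllZdPer τ L P₀ Λ_b ops₀` at `(M, i′, n)`.
[cite: Balaban1985BackgroundPropagators, Thm 3.3 p.399, (3.47) p.398, (3.45) p.398, (3.26)–(3.27) p.395, Thm 3.11 p.416; Balaban1985RegularSpaces, (1.58)–(1.59) p.86, p.77 («Ω_j = T_η»)] -/
theorem binders_torusIdx_of_defY (hd2 : 2 ≤ d + 1) (hL1 : 1 ≤ ℓ + 1)
    (hτp : ∀ a : 𝔸, a ≠ 0 → 0 < (τ (star a * a)).re) (hτt : ∀ a b : 𝔸, τ (a * b) = τ (b * a))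
    (hτs : ∀ a : 𝔸, τ (star a) = starRingEnd ℂ (τ a))
    (hlev : ∀ z : SiteY i, levY i z = n) (hcf : i.cf = (((ℓ + 1 : ℕ) : ℝ)) ^ (n + 1)) {η : ℝ} (hη : 0 < η) {k : ℕ} (hk : 1 ≤ k)
    (hdvd : (ℓ + 1) ^ n ∣ (PV d ℓ i.m i.K hd hL).sitesPerDir 0)
    (ops₀ : ℝ → ZdIdx (d + 1) (ℓ + 1) → ℕ → OpsZd (d + 1) 𝔸) (M : ℝ)
    (parS : SiteParY 𝔸 i) (parB : BondParY 𝔸 i) (Gp : SiteOpY 𝔸 i) {B₀ ε aT : ℝ} (hB₀ : 0 < B₀) (hε : 0 ≤ ε) (hεB : 2 * ε * B₀ ≤ 1)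
    (hY : ∀ (α₀ : ℝ) (U₀ : LSite (d + 1) → Fin (d + 1) → 𝔸ˣ), (∀ x κ, U₀ x κ ∈ unitaryUnits 𝔸) →
      IsPeriodic ((PV d ℓ i.m i.K hd hL).sitesPerDir 0) U₀ → 0 < α₀ → α₀ ≤ aT →
      InAk (ℓ + 1) n η α₀ (fun _ => (Set.univ : Set (LSite (d + 1)))) U₀ →
        IsUnit (deltaAY i parS parB Gp (bgY i U₀)) ∧
        (∀ F, wNormBY i (-1) (GAY i parS parB Gp (bgY i U₀) F) ≤ B₀ * wNormBY i (-3) F) ∧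
        (∀ F ν, wNormBY i (-2) (cdB i (bgY i U₀) ν (GAY i parS parB Gp (bgY i U₀) F)) ≤ B₀ * wNormBY i (-3) F) ∧
        (∀ F, wNormBY i (-3) (lapB i (bgY i U₀) (GAY i parS parB Gp (bgY i U₀) F)) ≤ B₀ * wNormBY i (-3) F) ∧
        (∀ a : FBondY i → 𝔸, (∀ b, IsSelfAdjoint (a b)) →
          wNormBY i (-3) (deltaAY i parS parB Gp (bgY i U₀) a - ((i.cf * η) ^ 2 : ℝ) •
            descBd i (deltaAOf η (opsAllZdPer τ (ℓ + 1) ((PV d ℓ i.m i.K hd hL).sitesPerDir 0) (fun m => torusLamb (d := d + 1) m) ops₀ M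
              (torusIdx (d := d + 1) hL1 ⟨η, hη, k, hk⟩) n) U₀ (liftBd i a))) ≤ ε * wNormBY i (-1) a)) :
    InvAtHIPer ((PV d ℓ i.m i.K hd hL).sitesPerDir 0) (ℓ + 1)
        (opsAllZdPer τ (ℓ + 1) ((PV d ℓ i.m i.K hd hL).sitesPerDir 0) (fun m => torusLamb (d := d + 1) m) ops₀) aT M
        (torusIdx (d := d + 1) hL1 ⟨η, hη, k, hk⟩) n ∧
      GlobAtIPer ((PV d ℓ i.m i.K hd hL).sitesPerDir 0) (ℓ + 1)
        (opsAllZdPer τ (ℓ + 1) ((PV d ℓ i.m i.K hd hL).sitesPerDir 0) (fun m => torusLamb (d := d + 1) m) ops₀) aT (2 * B₀) M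
        (torusIdx (d := d + 1) hL1 ⟨η, hη, k, hk⟩) n := by
  haveI : NeZero ((PV d ℓ i.m i.K hd hL).sitesPerDir 0) := ⟨(PV d ℓ i.m i.K hd hL).sitesPerDir_ne_zero 0⟩
  set P₀ := (PV d ℓ i.m i.K hd hL).sitesPerDir 0 with hP₀
  set t : TorusMember := ⟨η, hη, k, hk⟩ with ht
  set ΛbP : ℕ → ℕ → Set (LSite (d + 1) × Fin (d + 1)) := fun m => torusLamb (d := d + 1) m with hΛbP
  have hL2 : 2 ≤ ℓ + 1 := hL.2
  -- structural facts of the torus record at the torus datum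
  have hbox := hbox_torusIdx (d := d) hL1 t n
  have hΛ : ∀ j, j ≤ n → ∀ κ : Fin (d + 1), IsPeriodic (P₀ / (ℓ + 1) ^ j) (fun z => (z, κ) ∈ (torusIdx (d := d + 1) hL1 t).Λb n j) :=
    fun j _ κ => isPeriodic_mem_torusLamb' _ n j κ
  have hlin : ∀ {U₀ : LSite (d + 1) → Fin (d + 1) → 𝔸ˣ}, (∀ x κ, U₀ x κ ∈ unitaryUnits 𝔸) →
      B9Eq327GreenZd.LinearOnDomAt η (opsAllZdPer τ (ℓ + 1) P₀ ΛbP ops₀ M (torusIdx (d := d + 1) hL1 t) n) Set.univ U₀ :=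
    fun hUu => linearOnDomAt_opsAllZdPer_univ τ P₀ hL2 ΛbP ops₀ M (torusIdx (d := d + 1) hL1 t) n hbox hUu
  have hpres : ∀ {U₀ : LSite (d + 1) → Fin (d + 1) → 𝔸ˣ}, (∀ x κ, U₀ x κ ∈ unitaryUnits 𝔸) → IsPeriodic P₀ U₀ →
      B9Eq327GreenZdHermPer.PerPreservingAt η (opsAllZdPer τ (ℓ + 1) P₀ ΛbP ops₀ M (torusIdx (d := d + 1) hL1 t) n) P₀ U₀ :=
    fun hUu hU => perPreservingAt_opsAllZdPer τ P₀ hL2 hτp hτt hτs ΛbP ops₀ M (torusIdx (d := d + 1) hL1 t) hUu hU hdvd hΛ hbox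
  -- the junction (file 7c′) at one background
  have hJct : ∀ (α₀ : ℝ) (U₀ : LSite (d + 1) → Fin (d + 1) → 𝔸ˣ), (∀ x κ, U₀ x κ ∈ unitaryUnits 𝔸) → IsPeriodic P₀ U₀ → 0 < α₀ → α₀ ≤ aT →
      InAk (ℓ + 1) n η α₀ (fun _ => (Set.univ : Set (LSite (d + 1)))) U₀ →
      RegularAtHPer η (opsAllZdPer τ (ℓ + 1) P₀ ΛbP ops₀ M (torusIdx (d := d + 1) hL1 t) n) P₀ U₀ ∧
        ∀ J ∈ domSubHPer (d := d + 1) (𝔸 := 𝔸) P₀,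
          msup (ℓ + 1) n η (-(1 : ℝ)) (fun _ (_ : LSite (d + 1) × Fin (d + 1)) => True)
              (fun b => gopZdHPer η (opsAllZdPer τ (ℓ + 1) P₀ ΛbP ops₀ M (torusIdx (d := d + 1) hL1 t) n) P₀ U₀ J b.1 b.2) ≤
            2 * B₀ * bondNorm (ℓ + 1) n η (-(3 : ℝ)) (fun _ => (Set.univ : Set (LSite (d + 1)))) J ∧
          msup (ℓ + 1) n η (-(2 : ℝ)) (fun _ (_ : Fin (d + 1) × Fin (d + 1) × LSite (d + 1)) => True)
              (fun q => covDerivFwd η U₀ q.1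
                (fun z => gopZdHPer η (opsAllZdPer τ (ℓ + 1) P₀ ΛbP ops₀ M (torusIdx (d := d + 1) hL1 t) n) P₀ U₀ J z q.2.1) q.2.2) ≤
            2 * B₀ * bondNorm (ℓ + 1) n η (-(3 : ℝ)) (fun _ => (Set.univ : Set (LSite (d + 1)))) J ∧
          bondNorm (ℓ + 1) n η (-(3 : ℝ)) (fun _ => (Set.univ : Set (LSite (d + 1))))
              (fun x μ => covLap η U₀
                (fun z => gopZdHPer η (opsAllZdPer τ (ℓ + 1) P₀ ΛbP ops₀ M (torusIdx (d := d + 1) hL1 t) n) P₀ U₀ J z μ) x) ≤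
            2 * B₀ * bondNorm (ℓ + 1) n η (-(3 : ℝ)) (fun _ => (Set.univ : Set (LSite (d + 1)))) J := by
    intro α₀ U₀ hUu hU hα hαT hIn
    obtain ⟨hΔ, hG0, hG1, hG3, hE⟩ := hY α₀ U₀ hUu hU hα hαT hIn
    exact gopZdHPer_three_members_herm i hlev hcf hη hU (hlin hUu) (hpres hUu hU) parS parB Gp hΔ hB₀.le hε hεB hG0 hG1 hG3 hE
  refine ⟨?_, ?_⟩
  · -- `InvAtHIPer` from `RegularAtHPer` at every background of the class (dag-n06-b's `invAtHIPer_withGopZdHPer`)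
    have hreg : RegularInClassAtHPer P₀ (ℓ + 1)
        (opsLandauPer τ P₀ (withDpZd (withQQP τ (ℓ + 1) ΛbP ops₀))) aT M (torusIdx (d := d + 1) hL1 t) n := by
      intro α₀ U₀ hUu hU hαT hIn
      exact (hJct α₀ U₀ hUu hU (alpha_pos_of_inAk_univ hd2 hIn) hαT hIn).1
    exact invAtHIPer_withGopZdHPer P₀ _ M (torusIdx (d := d + 1) hL1 t) n rfl hreg
  · -- `GlobAtIPer` with constant `2B₀`
    intro α₀ U₀ hUu hU hα hαT hIn J hJ
    obtain ⟨h0, h1, h3⟩ := (hJct α₀ U₀ hUu hU hα hαT hIn).2 J hJ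
    rw [sideTouches_torusIdx_eq hd2 hL1 t, sideTouches_torusIdx_eq₃ hd2 hL1 t]
    exact ⟨h0, h1, h3⟩

omit [Nontrivial 𝔸] in
/-- the torus record's `Gop` (dag-n06-b's periodic Green's function `gopZdHPer`) is periodic on every input — the `hGper` input of the β = 0 Hölder file 8a
(`B9B8KnitHolderZeroOfGlob.holderAtIPer_zero_of_globAtIPer`). [cite: Balaban1985BackgroundPropagators, (3.27) p.395; Balaban1985RegularSpaces, p.77 («Ω_j = T_η»), bookkeeping] -/
theorem gop_isPeriodic_opsAllZdPer {L : ℕ} (P : ℕ) (ΛbP : ℕ → ℕ → Set (LSite (d + 1) × Fin (d + 1)))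
    (ops₀ : ℝ → ZdIdx (d + 1) L → ℕ → OpsZd (d + 1) 𝔸) (M : ℝ) (i' : ZdIdx (d + 1) L) (m : ℕ)
    (U₀ : LSite (d + 1) → Fin (d + 1) → 𝔸ˣ) (J : LSite (d + 1) → Fin (d + 1) → 𝔸) :
    IsPeriodic P ((opsAllZdPer τ L P ΛbP ops₀ M i' m).Gop U₀ J) :=
  ((mem_domSubHPer_iff P _).1 (gopZdHPer_mem_domSubHPer i'.η _ P U₀ J)).1

end Binders

/-! ## §3 The guarded socket at the torus datum -/

section Socket

variable [Nontrivial 𝔸] [FiniteDimensional ℝ 𝔸] (τ : 𝔸 →ₗ[ℂ] ℂ) (i : KIdx d ℓ hd hL b₀ b₁) {n : ℕ}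

/-- ★★★ **[B8] (1.59) ON THE TORUS — pub-ymgap's GUARDED SOCKET `SockB9P3Per` AT THE TORUS DATUM FROM THE PER-BACKGROUND def-Y BINDER.**  Same data
and hypothesis `hY` as `binders_torusIdx_of_defY`, plus a fibre constant `|Re τ(x*y)| ≤ C_τ‖x‖‖y‖` and the Hölder binder `HolderAtIPer … a_T C_β β len` (at
`β = 0` it follows from `GlobAtIPer` by file 8a).  Conclusion: `SockB9P3Per P₀ L B₀′ B₀β′ c_P β len η n {ℤ^{d+1}} torusLam torusLamb` with dag-n06-b's constants
at `B₀ ↦ 2B₀`, `a_I = a_T`, `c₆₉ = 14d`, `q = qQ (d+1) L C_τ β_τ 0` — by `B9SupplySockB9P3ZdPer.sockB9P3Per_opsAllZdPer_of_binders` (Prop. 3's chain on the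
torus) fed with §2.  This is the `m′ = n` instance of the (B)-arrow hypothesis of `B8Thm2T3FamilyBinderSockPer.hThm2_of_core_sockPer`, modulo the
displayed `hY` and the Hölder binder.
[cite: Balaban1985RegularSpaces, (1.58)–(1.59) p.86, Prop. 3 p.87, p.77 («Ω_j = T_η»); Balaban1985BackgroundPropagators, Thm 3.3 p.399, Thm 3.11 p.416, (3.26)–(3.27) p.395] -/
theorem sockB9P3Per_torusIdx_of_defY (hd2 : 2 ≤ d + 1) (hL1 : 1 ≤ ℓ + 1)
    (hτp : ∀ a : 𝔸, a ≠ 0 → 0 < (τ (star a * a)).re) (hτt : ∀ a b : 𝔸, τ (a * b) = τ (b * a))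
    (hτs : ∀ a : 𝔸, τ (star a) = starRingEnd ℂ (τ a)) {Cτ : ℝ} (hCτ : ∀ x y : 𝔸, |(τ (star x * y)).re| ≤ Cτ * ‖x‖ * ‖y‖)
    (hlev : ∀ z : SiteY i, levY i z = n) (hcf : i.cf = (((ℓ + 1 : ℕ) : ℝ)) ^ (n + 1)) {η : ℝ} (hη : 0 < η) {k : ℕ} (hk : 1 ≤ k)
    (hdvd : (ℓ + 1) ^ n ∣ (PV d ℓ i.m i.K hd hL).sitesPerDir 0)
    (ops₀ : ℝ → ZdIdx (d + 1) (ℓ + 1) → ℕ → OpsZd (d + 1) 𝔸) {M : ℝ} (hM1 : 1 ≤ M)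
    (parS : SiteParY 𝔸 i) (parB : BondParY 𝔸 i) (Gp : SiteOpY 𝔸 i) {B₀ ε aT : ℝ} (hB₀ : 0 < B₀) (hε : 0 ≤ ε) (hεB : 2 * ε * B₀ ≤ 1)
    (hY : ∀ (α₀ : ℝ) (U₀ : LSite (d + 1) → Fin (d + 1) → 𝔸ˣ), (∀ x κ, U₀ x κ ∈ unitaryUnits 𝔸) →
      IsPeriodic ((PV d ℓ i.m i.K hd hL).sitesPerDir 0) U₀ → 0 < α₀ → α₀ ≤ aT →
      InAk (ℓ + 1) n η α₀ (fun _ => (Set.univ : Set (LSite (d + 1)))) U₀ →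
        IsUnit (deltaAY i parS parB Gp (bgY i U₀)) ∧
        (∀ F, wNormBY i (-1) (GAY i parS parB Gp (bgY i U₀) F) ≤ B₀ * wNormBY i (-3) F) ∧
        (∀ F ν, wNormBY i (-2) (cdB i (bgY i U₀) ν (GAY i parS parB Gp (bgY i U₀) F)) ≤ B₀ * wNormBY i (-3) F) ∧
        (∀ F, wNormBY i (-3) (lapB i (bgY i U₀) (GAY i parS parB Gp (bgY i U₀) F)) ≤ B₀ * wNormBY i (-3) F) ∧
        (∀ a : FBondY i → 𝔸, (∀ b, IsSelfAdjoint (a b)) →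
          wNormBY i (-3) (deltaAY i parS parB Gp (bgY i U₀) a - ((i.cf * η) ^ 2 : ℝ) •
            descBd i (deltaAOf η (opsAllZdPer τ (ℓ + 1) ((PV d ℓ i.m i.K hd hL).sitesPerDir 0) (fun m => torusLamb (d := d + 1) m) ops₀ M
              (torusIdx (d := d + 1) hL1 ⟨η, hη, k, hk⟩) n) U₀ (liftBd i a))) ≤ ε * wNormBY i (-1) a))
    {Cβ β : ℝ} {len : LSite (d + 1) → ℝ}
    (hhol : HolderAtIPer ((PV d ℓ i.m i.K hd hL).sitesPerDir 0) (ℓ + 1)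
      (opsAllZdPer τ (ℓ + 1) ((PV d ℓ i.m i.K hd hL).sitesPerDir 0) (fun m => torusLamb (d := d + 1) m) ops₀) aT Cβ β len M
      (torusIdx (d := d + 1) hL1 ⟨η, hη, k, hk⟩) n) :
    SockB9P3Per (𝔸 := 𝔸) ((PV d ℓ i.m i.K hd hL).sitesPerDir 0) (ℓ + 1)
      (max 1 (2 * (2 * B₀) * max 1 (qQ (d + 1) (ℓ + 1) Cτ (betaTau τ) 0)))
      (2 * max 0 Cβ * max 1 (qQ (d + 1) (ℓ + 1) Cτ (betaTau τ) 0))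
      (min (1 / 16) (min aT (min aT (1 / (2 * (2 * B₀) * (14 * ((d + 1 - 1 : ℕ) : ℝ)) * M + 1)))))
      β len η n (fun _ => (Set.univ : Set (LSite (d + 1)))) (fun m => torusLam (d := d + 1) m) (fun m => torusLamb (d := d + 1) m) := by
  haveI : NeZero ((PV d ℓ i.m i.K hd hL).sitesPerDir 0) := ⟨(PV d ℓ i.m i.K hd hL).sitesPerDir_ne_zero 0⟩
  have hL2 : 2 ≤ ℓ + 1 := hL.2
  obtain ⟨hinv, hglob⟩ :=
    binders_torusIdx_of_defY τ i hd2 hL1 hτp hτt hτs hlev hcf hη hk hdvd ops₀ M parS parB Gp hB₀ hε hεB hY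
  exact sockB9P3Per_opsAllZdPer_of_binders (ℓ + 1) τ ((PV d ℓ i.m i.K hd hL).sitesPerDir 0) hd2 hL2 hτp hτt hτs hCτ ops₀ hM1
    (torusIdx (d := d + 1) hL1 ⟨η, hη, k, hk⟩) rfl hdvd (fun j _ κ => isPeriodic_mem_torusLamb' _ n j κ)
    (levelSepPP0_torusIdx (d := d) hL1 _ n) hinv hglob hhol (by positivity)

end Socket

end Literature.MathematicalPhysics.QuantumFieldTheory.Balaban1983to89.B9B8KnitTorusGlobPackaging
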